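import Summits.BirchSwinnertonDyer.BirchSwinnertonDyer.Theorems.SmallImageMuTransferMuTransferX9StepFourReciprocitySets
import Literature.NumberTheory.EllipticCurves.KummerImageIsotropy
import HarnessLib

/-!
# K6 crux `MuTransferX9` (stmt-BirchSwinnertonDyer-19276), MU-TRANSFER-PROOF §5 STEP 4 on the objects of
# skeleton v5's `stub_stepsTwoFourX9` THEMSELVES: `𝒯_J(E) = W.modPTwist p κ J`, the dual twist
# `W.modPTwist p κ.invTwist J`, a Weil pairing `eW` given by its six raw clauses (`weilPairingHom`), over `ℚ`

Cell `b2b-bsdres`, unit `b2b-bsdres-x10` (N2 = X10b at `p = 3` class lead, GEN 38; G4 = STEP 4 hand of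
the assembler's cut, crux 19276, cell `bsd-smallim`; skeleton v5 sha16 bbfcbeb8eb041500). HONEST FRAMING:
TOOL theorems; no definition, no named fact, no `sorry`; nothing is asserted about any curve, nothing is
booked; X9 stays TYPED at class level, X10b (N2) keeps its label CONSTRUCTION-SHAPED / NEEDS X_A3.
`--supports stmt-BirchSwinnertonDyer-19276` (helper; closes nothing). PARTITION (D-0054): X9 (A4) ×
`p ∈ {5, 7}` · X10b (A5) × `p = 3` — the hypothesis is `p ≠ 2` (ClassX9-free), so one statement serves both.

## Content

The sequel of `…X9StepFourReciprocity{,Twist,Seams,Sets}` with every binder in the TYPES of the stub: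

* `weilPairingHom_torsionGaloisModule_smul` — the equivariance `he` of k6-ty's `twistContPairing` /
  `twistDualMap` for `e = weilPairingHom W p eW hμ hadd₁ hadd₂` from the stub's clause
  `∀ σ S T, σ • eW S T = eW (σ • S) (σ • T)` (tree `weilContPairing.toLin_smul`);
* **`localTerm_iterate_shiftH1_modPTwist_eq_zero`** — `W : WeierstrassCurve ℚ`, `p ≠ 2`,
  `κ : ZpExtension ℚ p`, `inv : LocalInvariants ℚ p` with the Poitou–Tate vanishing (the stub's
  `poitouTate_sum_localTatePairing_eq_zero ℚ` yields it), `S : Set` with `(p) ∈ S` and every bad prime in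
  `S` (`hSp`, `hur` — the prover's `S₀ ⊆ S₁`), `q ∉ S`; `x ∈ H¹(ℚ, W.modPTwist p κ J)` unramified off
  `S ∪ {q}` (the Kolyvagin class of G3); `Ψ ∈ H¹(ℚ, W.modPTwist p κ.invTwist J)` with the stub's two clauses
  VERBATIM (unramified off `S`; `loc_v ((κ.invTwist.shiftH1 …)^[ε] Ψ) = 0` on `S`); `eW, hμ, hadd₁, hadd₂,
  hgal` as in the stub ⟹ for EVERY `k`, the local term at `q` of
  `((κ.shiftH1 …)^[k] x, (twistDualMap)_* ((κ.invTwist.shiftH1 …)^[ε] Ψ))` VANISHES;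
* `inv_cupProduct_restrict_iterate_localShift_modPTwist_eq_zero` — the same read on local classes at `q`
  (restricted `twistContPairing` through the Weil pairing; koly's `q`-term currency).

`W.modPTwist p κ J` is `κ.twistModP (W.torsionGaloisModule p) (fun P => torsionBy.nsmul P) J` by `rfl`,
so the proofs are `exact` of the `Sets` file. What remains for `stub_stepsTwoFourX9` after this file:
G3's `κ_q` (for `x`, `hx`, and its transverse value), koly's `q`-term identity, and the packaging
`StepFour.convCoeff_eq_zero_of_family_eq_zero'` (landed) — no further instantiation of STEP 4.

References: MU-TRANSFER-PROOF §5 STEP 4, (F7), (4.1); J. S. Milne, *Arithmetic Duality Theorems* (2006),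
I Thm. 4.10 (b), Thm. 2.6 [MilneADT2006]; J. H. Silverman, *AEC* (2009) Prop. III.8.1 [SilvermanAEC2009].
-/

-- the summit and its single problem are both named `BirchSwinnertonDyer` (registry layout D-0017)
set_option linter.dupNamespace false

set_option autoImplicit false

noncomputable section

open scoped ContRepresentation
open Function NumberField IsDedekindDomain Field
open scoped NumberField
open Literature.NumberTheory.GaloisRepresentations
open Literature.NumberTheory.GaloisRepresentations.DiscreteGaloisModule (mu MuCarrier pairing TateDual
  tateDual pairingDualIntertwining)
open Literature.NumberTheory.GaloisCohomology
open Literature.NumberTheory.EllipticCurves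
open Summit.BirchSwinnertonDyer.Rank1Residual.GaloisImage

namespace Summit.BirchSwinnertonDyer.BirchSwinnertonDyer.Rank1Residual.StepFour

variable (W : WeierstrassCurve ℚ) (p : ℕ) [Fact p.Prime] (κ : ZpExtension ℚ p)
variable (eW : WeierstrassCurve.geomTorsion W (p : ℤ) → WeierstrassCurve.geomTorsion W (p : ℤ) →
    AlgebraicClosure ℚ)
  (hμ : ∀ S T, eW S T ^ p = 1) (hadd₁ : ∀ S₁ S₂ T, eW (S₁ + S₂) T = eW S₁ T * eW S₂ T)
  (hadd₂ : ∀ S T₁ T₂, eW S (T₁ + T₂) = eW S T₁ * eW S T₂)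
  (hgal : ∀ (σ : absoluteGaloisGroup ℚ) (S T : WeierstrassCurve.geomTorsion W (p : ℤ)),
    σ • eW S T = eW (σ • S) (σ • T))

include hgal in
/-- **The equivariance `he` of the Weil pairing hom** in the shape k6-ty's `twistContPairing` /
`twistDualMap` consume (`e (ρ g m) (ρ g m′) = μ_p(g) (e m m′)`), from the stub's clause
`σ • eW S T = eW (σ • S) (σ • T)` (tree `weilContPairing`, `ContPairing.toLin_smul`).
[cite: SilvermanAEC2009, Prop. III.8.1] -/
theorem weilPairingHom_torsionGaloisModule_smul (g : absoluteGaloisGroup ℚ)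
    (m m' : WeierstrassCurve.geomTorsion W (p : ℤ)) :
    weilPairingHom W p eW hμ hadd₁ hadd₂ (W.torsionGaloisModule (p : ℤ) g m)
        (W.torsionGaloisModule (p : ℤ) g m') =
      mu ℚ p g (weilPairingHom W p eW hμ hadd₁ hadd₂ m m') :=
  (weilContPairing W p eW hμ hadd₁ hadd₂ hgal).toLin_smul g m m'

/-- **MU-TRANSFER-PROOF §5 STEP 4 on the objects of skeleton v5's `stub_stepsTwoFourX9`.** `p ≠ 2`
(ClassX9-free: serves X9 and X10b), `inv : LocalInvariants ℚ p` with the Poitou–Tate vanishing, `S` a set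
of primes containing `(p)` and the primes where `E[p]` ramifies (`hSp`, `hur`), `q ∉ S`;
`x ∈ H¹(ℚ, 𝒯_J(E, κ))` unramified off `S ∪ {q}` (the Kolyvagin class); `Ψ ∈ H¹(ℚ, 𝒯_J(E, κ⁻¹))` with the
stub's two clauses verbatim; a Weil pairing `eW` (stub clauses). Then for EVERY `k` the Poitou–Tate local
term at `q` of `(T^k x, (twistDualMap)_* (T^ε Ψ))` vanishes — every member of the coefficient family of
(F7) is zero. [cite: MilneADT2006, Ch. I, Thm. 4.10(b)] -/
theorem localTerm_iterate_shiftH1_modPTwist_eq_zero [W.IsElliptic]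
    [Finite (WeierstrassCurve.geomTorsion W (p : ℤ))] (hp : p ≠ 2)
    {inv : LocalInvariants ℚ p} (hPT : inv.SumLocalTermEqZero) (J : ℕ)
    (S : Set (HeightOneSpectrum (𝓞 ℚ))) (q : HeightOneSpectrum (𝓞 ℚ)) (hq : q ∉ S)
    (hSp : ∀ v ∉ S, ((p : ℕ) : 𝓞 ℚ) ∉ v.asIdeal)
    (hur : ∀ v ∉ S, GaloisRep.IsUnramifiedAt v (W.torsionGaloisModule (p : ℤ)))
    (x : galoisCohomology (W.modPTwist p κ J) 1)
    (hx : ∀ v ∉ S, v ≠ q → galoisCohomology.localization (W.modPTwist p κ J) (Sum.inr v) 1 x ∈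
      DiscreteGaloisModule.unramifiedSubgroup (GaloisRep.toLocal v (W.modPTwist p κ J)) 1)
    (Ψ : galoisCohomology (W.modPTwist p κ.invTwist J) 1)
    (hΨ : ∀ v : HeightOneSpectrum (𝓞 ℚ), v ∉ S →
      galoisCohomology.localization (W.modPTwist p κ.invTwist J) (Sum.inr v) 1 Ψ ∈
        DiscreteGaloisModule.unramifiedSubgroup (GaloisRep.toLocal v (W.modPTwist p κ.invTwist J)) 1)
    (ε : ℕ)
    (hΨS : ∀ v : HeightOneSpectrum (𝓞 ℚ), v ∈ S →
      galoisCohomology.localization (W.modPTwist p κ.invTwist J) (Sum.inr v) 1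
        ((κ.invTwist.shiftH1 (W.torsionGaloisModule (p : ℤ))
          (fun P : WeierstrassCurve.geomTorsion W (p : ℤ) => AddSubgroup.torsionBy.nsmul P) J)^[ε] Ψ) = 0)
    (k : ℕ) :
    inv.localTerm (W.modPTwist p κ J) (Sum.inr q)
      ((κ.shiftH1 (W.torsionGaloisModule (p : ℤ))
        (fun P : WeierstrassCurve.geomTorsion W (p : ℤ) => AddSubgroup.torsionBy.nsmul P) J)^[k] x)
      (galoisCohomology.map (κ.twistDualMap (W.torsionGaloisModule (p : ℤ)) (W.torsionGaloisModule (p : ℤ))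
        p (fun P => AddSubgroup.torsionBy.nsmul P) (fun P => AddSubgroup.torsionBy.nsmul P) J
        (weilPairingHom_torsionGaloisModule_smul W p eW hμ hadd₁ hadd₂ hgal)) 1
        ((κ.invTwist.shiftH1 (W.torsionGaloisModule (p : ℤ))
          (fun P : WeierstrassCurve.geomTorsion W (p : ℤ) => AddSubgroup.torsionBy.nsmul P) J)^[ε] Ψ)) = 0 := by
  unfold WeierstrassCurve.modPTwist at x hx Ψ hΨ hΨS ⊢
  exact localTerm_iterate_shiftH1_eq_zero_of_stub_hypotheses κ (W.torsionGaloisModule (p : ℤ))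
    (W.torsionGaloisModule (p : ℤ)) (fun P => AddSubgroup.torsionBy.nsmul P)
    (fun P => AddSubgroup.torsionBy.nsmul P) J
    (weilPairingHom_torsionGaloisModule_smul W p eW hμ hadd₁ hadd₂ hgal) hp hPT S q hq hSp hur x hx Ψ hΨ ε
    hΨS k

/-- **The same read on LOCAL classes at `q`** (restricted `twistContPairing` through the Weil pairing;
the `q`-term currency of Lemma 1 (iii)): `inv_q(T_q^k (loc_q x) ∪ loc_q (T^ε Ψ)) = 0` for every `k`.
[cite: MilneADT2006, Ch. I, Thm. 4.10(b)] -/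
theorem inv_cupProduct_restrict_iterate_localShift_modPTwist_eq_zero [W.IsElliptic]
    [Finite (WeierstrassCurve.geomTorsion W (p : ℤ))] [LocallyCompactSpace (absoluteGaloisGroup ℚ)]
    (hp : p ≠ 2) {inv : LocalInvariants ℚ p} (hPT : inv.SumLocalTermEqZero) (J : ℕ)
    (S : Set (HeightOneSpectrum (𝓞 ℚ))) (q : HeightOneSpectrum (𝓞 ℚ)) (hq : q ∉ S)
    [LocallyCompactSpace (absoluteGaloisGroup (Place.Completion (Sum.inr q : Place ℚ)))]
    (hSp : ∀ v ∉ S, ((p : ℕ) : 𝓞 ℚ) ∉ v.asIdeal)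
    (hur : ∀ v ∉ S, GaloisRep.IsUnramifiedAt v (W.torsionGaloisModule (p : ℤ)))
    (x : galoisCohomology (W.modPTwist p κ J) 1)
    (hx : ∀ v ∉ S, v ≠ q → galoisCohomology.localization (W.modPTwist p κ J) (Sum.inr v) 1 x ∈
      DiscreteGaloisModule.unramifiedSubgroup (GaloisRep.toLocal v (W.modPTwist p κ J)) 1)
    (Ψ : galoisCohomology (W.modPTwist p κ.invTwist J) 1)
    (hΨ : ∀ v : HeightOneSpectrum (𝓞 ℚ), v ∉ S →
      galoisCohomology.localization (W.modPTwist p κ.invTwist J) (Sum.inr v) 1 Ψ ∈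
        DiscreteGaloisModule.unramifiedSubgroup (GaloisRep.toLocal v (W.modPTwist p κ.invTwist J)) 1)
    (ε : ℕ)
    (hΨS : ∀ v : HeightOneSpectrum (𝓞 ℚ), v ∈ S →
      galoisCohomology.localization (W.modPTwist p κ.invTwist J) (Sum.inr v) 1
        ((κ.invTwist.shiftH1 (W.torsionGaloisModule (p : ℤ))
          (fun P : WeierstrassCurve.geomTorsion W (p : ℤ) => AddSubgroup.torsionBy.nsmul P) J)^[ε] Ψ) = 0)
    (k : ℕ) :
    inv (Sum.inr q)
      (((κ.twistContPairing (W.torsionGaloisModule (p : ℤ)) (W.torsionGaloisModule (p : ℤ)) (mu ℚ p)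
            (fun P => AddSubgroup.torsionBy.nsmul P) (fun P => AddSubgroup.torsionBy.nsmul P) J
            (weilPairingHom_torsionGaloisModule_smul W p eW hμ hadd₁ hadd₂ hgal)).restrict
          (absGaloisRestrict ℚ (Place.Completion (Sum.inr q : Place ℚ)))).cupProduct
        ((galoisCohomology.map ((κ.twistModPShift (W.torsionGaloisModule (p : ℤ))
            (fun P => AddSubgroup.torsionBy.nsmul P) J).restrictField (q.adicCompletion ℚ)) 1)^[k]
          (galoisCohomology.localization (W.modPTwist p κ J) (Sum.inr q) 1 x))
        (galoisCohomology.localization (W.modPTwist p κ.invTwist J) (Sum.inr q) 1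
          ((κ.invTwist.shiftH1 (W.torsionGaloisModule (p : ℤ))
            (fun P : WeierstrassCurve.geomTorsion W (p : ℤ) => AddSubgroup.torsionBy.nsmul P) J)^[ε] Ψ))) =
      0 := by
  unfold WeierstrassCurve.modPTwist at x hx Ψ hΨ hΨS ⊢
  exact inv_cupProduct_restrict_iterate_localShift_eq_zero_of_stub_hypotheses κ
    (W.torsionGaloisModule (p : ℤ)) (W.torsionGaloisModule (p : ℤ)) (fun P => AddSubgroup.torsionBy.nsmul P)
    (fun P => AddSubgroup.torsionBy.nsmul P) J
    (weilPairingHom_torsionGaloisModule_smul W p eW hμ hadd₁ hadd₂ hgal) hp hPT S q hq hSp hur x hx Ψ hΨ ε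
    hΨS k

end Summit.BirchSwinnertonDyer.BirchSwinnertonDyer.Rank1Residual.StepFour

end
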